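import Summits.ABC.IUTFork.Joshi.TestGenuinePinsVacuityQuadratic
import HarnessLib

/-!
# Branch E TEST — the genuine-carrier pins are UNSATISFIABLE over EVERY number field containing `√d`, `d` squarefree, `d ∉ {1, 3}`
# (any degree; no `√−1`, no initial Θ-datum)

Proof-only sequel (abc-iut cell, D-0079 R-J «Joshi Y-discharge census», row Y-26 residual class; seat abc-iut-E-t43, gen 4; 0 definitions,
no `Prop` fact, FACT rows used: none) to this seat's `Joshi/TestGenuinePinsVacuityQuadratic.lean` (p461750), lifting its dyadic cases from
quadratic fields to ARBITRARY number fields `F ∋ s`, `s² = d`: at a place `v ∣ 2` one has `e(v|2) ≥ 2` as soon as `d ≡ 2, 3 (mod 4)`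
(abc-iut-w4-d017's `two_le_ramificationIdx_of_sq_eq`, any `F`); if `(e, f) ≠ (2, 1)` abc-iut-c312-5's complete dyadic column moves `𝒪_v`;
if `(e, f) = (2, 1)` abc-iut-w4-d017's LOCAL quadratic readings apply (`Thm311RealIsmDHMoverWildQuadraticDyadic`: `‖d‖ = 1/2` ⇒ every ball
moves; `d ≡ 7 (mod 8)` ⇒ the unit ball moves).  All movers are consumed BY NAME and fed through `not_pinnedRegions_settingPrVolSharp_of_mover_at`
/ the per-place feeds into p446217's criterion.  Results — each `¬ Cor312Vol.PinnedRegions` (/ `¬ PinnedRegions3`) at abc-iut-c312-7's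
`settingPrVolSharp` over `LatticeSituation.ofShells (logShellsDH X (analyticLogv F)) …`, analytic logarithms, EVERY `X : PilotData F`, `ρ`, `qK`,
column data, `Ψ`, ideles, column:

* `not_pinnedRegions_settingPrVolSharp_of_sq_eq_two_mod_four` — every `F ∋ √d`, `d ≡ 2 (mod 4)`;
* `not_pinnedRegions_settingPrVolSharp_of_sq_eq_seven_mod_eight` — every `F ∋ √d`, `d ≡ 7 (mod 8)` (the case `d = −1` is abc-iut-E-t44's
  p446474 / abc-iut-w5-d039's `…_of_exists_sq_eq_neg_one`);
* **`not_pinnedRegions(3)_settingPrVolSharp_of_sq_eq_squarefree`** — EVERY number field `F ∋ √d` with `d` squarefree, `d ≠ 1`, `d ≠ 3`: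
  by `d mod 8` — `2 (mod 4)`, `7 (mod 8)` as above; `5 (mod 8)` the dyadic places of residue degree `≥ 2` (p461750); `1, 3 (mod 8)` a prime
  `q ≥ 5` with `q ∥ d` (p461750; the only squarefree `d ≡ 1, 3 (mod 8)` without such a prime are `1` and `3`).

WHAT STAYS OPEN in this currency: `F ∋ √3` of degree `> 2` all of whose dyadic places are `ℚ_2(√3)`-shaped (unit ball FIXED, w4-d017) and all
of whose places over `3` contain `ζ_3` — for `[F : ℚ] = 2` the place over `3` is `ℚ_3(√3)`-shaped and p461750's `…_of_quadratic` decides it.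
HONEST SCOPE: OUR interface, OUR sharp real container, Dupuy–Hilado's reading of (Ind2); nothing here bears on print's (xi-e)/(xi-f); locates /
conditionally verifies; no abc claim. [claim: Mochizuki2012, status: disputed] [cite: DupuyHilado2025, §4.9]
[cite: NeukirchANT1999, Ch. II Prop. (5.3), (5.5), (6.8)]
-/

noncomputable section

open Set Function NumberField IsDedekindDomain Metric
open scoped Pointwise

namespace Summit.ABC.IUTFork.Joshi

open Thm311 Thm311.Real Cor312 Cor312Vol Literature.IUT.LogThetaLattice Literature.IUT.LogVolume
  Literature.IUT.HodgeTheaters Literature.NumberTheory.NumberFields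
open GenuinePinsResidual

variable {F : Type} [Field F] [NumberField F] (X : PilotData F)
  (M : Type) [Field M] [NumberField M]
  (archPk : ∀ (j : (thetaIndex X).Label) (vQ : (thetaIndex X).VQ), Set ((logShellsDH X (analyticLogv F)).Packet j vQ))
  (archSub : ∀ (j : (thetaIndex X).Label) (v : (thetaIndex X).V),
    Set ((logShellsDH X (analyticLogv F)).Packet j ((thetaIndex X).over v)))
  (Ψ : ℤ → ∀ v : (thetaIndex X).V, v ∈ (thetaIndex X).Vbad → Set ((logShellsDH X (analyticLogv F)).StarPacket v))
  (act : ℤ → ∀ v : (thetaIndex X).V, v ∈ (thetaIndex X).Vbad →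
    (logShellsDH X (analyticLogv F)).StarPacket v → Module.End ℚ ((logShellsDH X (analyticLogv F)).StarPacket v))
  (Mmod : ℤ → ∀ j : (thetaIndex X).LabelStar, Set ((logShellsDH X (analyticLogv F)).GlobalPacket j.1))
  (region : ℤ → ∀ j : (thetaIndex X).LabelStar, FinDivisor M → ∀ vQ : (thetaIndex X).VQ,
    Set ((logShellsDH X (analyticLogv F)).Packet j.1 vQ))
  (frobAdm : ℤ → ℤ → ∀ (j : (thetaIndex X).Label) (vQ : (thetaIndex X).VQ),
    Set ((logShellsDH X (analyticLogv F)).Packet j vQ) → Prop)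
  (frobLogvol : ℤ → ℤ → ∀ (j : (thetaIndex X).Label) (vQ : (thetaIndex X).VQ),
    Set ((logShellsDH X (analyticLogv F)).Packet j vQ) → ℝ)
  (frobΨ : ℤ → ℤ → ∀ v : (thetaIndex X).V, v ∈ (thetaIndex X).Vbad → Set ((logShellsDH X (analyticLogv F)).StarPacket v))
  (frobMmod : ℤ → ℤ → ∀ j : (thetaIndex X).LabelStar, Set ((logShellsDH X (analyticLogv F)).GlobalPacket j.1))
  (unitImage : ℤ → ℤ → ℕ → ∀ (j : (thetaIndex X).Label) (vQ : (thetaIndex X).VQ),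
    Set ((logShellsDH X (analyticLogv F)).Packet j vQ))
  (ballImage : ℤ → ℤ → ∀ (j : (thetaIndex X).Label) (vQ : (thetaIndex X).VQ),
    Set ((logShellsDH X (analyticLogv F)).Packet j vQ))
  (thetaDiv : ℤ → ℤ → LgpDivisor M (thetaIndex X).lstar)
  (n : ℤ) {HT : Type} {LogLink : HT → HT → Type} {IsFull : ∀ {s t : HT}, LogLink s t → Prop}
  (lat : LGPGaussianLogThetaLattice LogLink IsFull)
  {Frd : Type} {IsoF : Frd → Frd → Type} {Ob : Frd → Type} {realify : Frd → Frd} {Strip : Type}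
  {IsoS : Strip → Strip → Type} {Mv : ∀ v : (thetaIndex X).V, v ∈ (thetaIndex X).Vbad → Type}
  [∀ v h, Monoid (Mv v h)]
  (sig : GlobalLGPFrobenioidSignature (thetaIndex X).lstar (thetaIndex X).V (· ∈ (thetaIndex X).Vbad)
    Frd IsoF Ob realify Strip IsoS Mv)
  (split : SplittingMonoids Mv) {ObΔ : Type} {N : ∀ v : (thetaIndex X).V, v ∈ (thetaIndex X).Vbad → Type}
  [∀ v h, Monoid (N v h)] (qData : QPilotData ObΔ N)
  (t : ∀ (pp : Nat.Primes) (_ : Fin X.lstar) (x : (thetaIndex X).Fibre (.inr pp)),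
    haveI : Fact (pp : ℕ).Prime := ⟨pp.2⟩; kOf X pp.1 x)
  (tq : ∀ (pp : Nat.Primes) (x : (thetaIndex X).Fibre (.inr pp)), haveI : Fact (pp : ℕ).Prime := ⟨pp.2⟩; kOf X pp.1 x)
  (ρ : (∀ v : (thetaIndex X).V, v ∈ (thetaIndex X).Vbad → Set ((logShellsDH X (analyticLogv F)).StarPacket v)) →
    ∀ (j : (thetaIndex X).Label) (vQ : (thetaIndex X).VQ), Set ((logShellsDH X (analyticLogv F)).Packet j vQ))
  (qK : ∀ v : (thetaIndex X).V, v ∈ (thetaIndex X).Vbad → Set ((logShellsDH X (analyticLogv F)).StarPacket v))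
  (htq0 : ∀ pp x, tq pp x ≠ 0)
  (htq1 : ∀ (pp : Nat.Primes) (x : (thetaIndex X).Fibre (.inr pp)),
    haveI : Fact (pp : ℕ).Prime := ⟨pp.2⟩; placeOf X pp.1 x ∉ X.S → ‖tq pp x‖ = 1)

/-! ## 1. `d ≡ 2 (mod 4)` and `d ≡ 7 (mod 8)`, any degree -/

/-- **EVERY `F ∋ s` WITH `s² = d`, `d ≡ 2 (mod 4)`: `PinnedRegions` FAILS at `settingPrVolSharp`** (analytic logarithms; every `X : PilotData F`,
`ρ`, `qK`, column data, `Ψ`, ideles, column): at a place `v₀ ∣ 2`, `e ≥ 2`; for `(e, f) ≠ (2, 1)` the complete dyadic column, for `(e, f) = (2, 1)`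
abc-iut-w4-d017's `‖d‖ = 1/2` reading moves the unit ball. [cite: DupuyHilado2025, §4.9] [cite: NeukirchANT1999, Ch. II Prop. (5.5)]
[claim: Mochizuki2012, status: disputed] -/
theorem not_pinnedRegions_settingPrVolSharp_of_sq_eq_two_mod_four {s : F} {d : ℤ} (hs : s ^ 2 = d) (hd : d % 4 = 2) :
    ¬ Cor312Vol.PinnedRegions
      (LatticeSituation.ofShells (logShellsDH X (analyticLogv F)) M archPk archSub
        (summandPiecesPr X (logvAnalytic_analyticLogv (F := F))).Adm
        (summandPiecesPr X (logvAnalytic_analyticLogv (F := F))).logvol Ψ act Mmod region frobAdm frobLogvol frobΨ frobMmod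
        unitImage ballImage thetaDiv)
      (settingPrVolSharp X (logvAnalytic_analyticLogv (F := F)) M archPk archSub Ψ act Mmod region n lat sig split qData tq t
        htq0 htq1) ρ qK := by
  haveI : Fact (Nat.Prime 2) := ⟨Nat.prime_two⟩
  obtain ⟨v₀, hv₀mem⟩ := placesOver_nonempty F 2
  have hres : residueChar F v₀ = 2 := (mem_placesOver_iff_residueChar v₀).mp hv₀mem
  have hv₀ : (thetaIndex X).over (.inr v₀) = .inr ⟨2, Nat.prime_two⟩ := by
    rw [over_inr_eq]; exact congrArg Sum.inr (Subtype.ext hres)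
  have hv : ((2 : ℕ) : 𝓞 F) ∈ v₀.asIdeal := natCast_mem_placeOf X (⟨2, Nat.prime_two⟩ : Nat.Primes) ⟨.inr v₀, hv₀⟩
  have he2 : 2 ≤ v₀.asIdeal.ramificationIdx ℤ := two_le_ramificationIdx_of_sq_eq v₀ hv hs (Or.inl hd)
  by_cases hef : v₀.asIdeal.ramificationIdx ℤ = 2 ∧ v₀.asIdeal.inertiaDeg ℤ = 1
  · have hmov := exists_mem_ismDH_image_closedBall_ne_of_norm_eq_half (logvAnalyticAt_analyticLogv (F := F) 2) v₀ hv hef.1 hef.2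
      (sq_of_algebraMap_eq v₀ hv hs) (padic_norm_intCast_eq_half_of_two_mod_four hd)
      (one_ne_zero : (1 : RescaledCompletion F 2 v₀ hv) ≠ 0)
    rw [norm_one] at hmov
    exact not_pinnedRegions_settingPrVolSharp_of_mover_at X M archPk archSub Ψ act Mmod region frobAdm frobLogvol frobΨ
          frobMmod unitImage ballImage thetaDiv n lat sig split qData t tq ρ qK htq0 htq1 2 v₀ hv hmov
  · exact not_pinnedRegions_settingPrVolSharp_of_dyadic_complete_anyPrime X M archPk archSub Ψ act Mmod region frobAdm frobLogvol frobΨ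
          frobMmod unitImage ballImage thetaDiv n lat sig split qData t tq ρ qK htq0 htq1 v₀ hv₀ he2 hef

/-- **EVERY `F ∋ s` WITH `s² = d`, `d ≡ 7 (mod 8)`** (e.g. `d = −1`, abc-iut-E-t44's p446474; `d = 7, 15, −9·…`): **`PinnedRegions` FAILS at
`settingPrVolSharp`** — at `v₀ ∣ 2`, `e ≥ 2`; the complete dyadic column off `(2, 1)`, abc-iut-w4-d017's `ℚ_2(√−1)`-type reading at `(2, 1)`.
[cite: DupuyHilado2025, §4.9] [cite: NeukirchANT1999, Ch. II Prop. (5.5)] [claim: Mochizuki2012, status: disputed] -/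
theorem not_pinnedRegions_settingPrVolSharp_of_sq_eq_seven_mod_eight {s : F} {d : ℤ} (hs : s ^ 2 = d) (hd : d % 8 = 7) :
    ¬ Cor312Vol.PinnedRegions
      (LatticeSituation.ofShells (logShellsDH X (analyticLogv F)) M archPk archSub
        (summandPiecesPr X (logvAnalytic_analyticLogv (F := F))).Adm
        (summandPiecesPr X (logvAnalytic_analyticLogv (F := F))).logvol Ψ act Mmod region frobAdm frobLogvol frobΨ frobMmod
        unitImage ballImage thetaDiv)
      (settingPrVolSharp X (logvAnalytic_analyticLogv (F := F)) M archPk archSub Ψ act Mmod region n lat sig split qData tq t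
        htq0 htq1) ρ qK := by
  haveI : Fact (Nat.Prime 2) := ⟨Nat.prime_two⟩
  obtain ⟨v₀, hv₀mem⟩ := placesOver_nonempty F 2
  have hres : residueChar F v₀ = 2 := (mem_placesOver_iff_residueChar v₀).mp hv₀mem
  have hv₀ : (thetaIndex X).over (.inr v₀) = .inr ⟨2, Nat.prime_two⟩ := by
    rw [over_inr_eq]; exact congrArg Sum.inr (Subtype.ext hres)
  have hv : ((2 : ℕ) : 𝓞 F) ∈ v₀.asIdeal := natCast_mem_placeOf X (⟨2, Nat.prime_two⟩ : Nat.Primes) ⟨.inr v₀, hv₀⟩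
  have he2 : 2 ≤ v₀.asIdeal.ramificationIdx ℤ := two_le_ramificationIdx_of_sq_eq v₀ hv hs (Or.inr (by omega))
  by_cases hef : v₀.asIdeal.ramificationIdx ℤ = 2 ∧ v₀.asIdeal.inertiaDeg ℤ = 1
  · exact not_pinnedRegions_settingPrVolSharp_of_mover_at X M archPk archSub Ψ act Mmod region frobAdm frobLogvol frobΨ
          frobMmod unitImage ballImage thetaDiv n lat sig split qData t tq ρ qK htq0 htq1 2 v₀ hv
      (exists_mem_ismDH_image_closedBall_one_ne_of_seven_mod_eight (logvAnalyticAt_analyticLogv (F := F) 2) v₀ hv hef.1 hef.2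
        (sq_of_algebraMap_eq v₀ hv hs) (padic_norm_one_sub_intCast_of_three_mod_four (by omega))
        (padic_norm_one_add_intCast_le_of_seven_mod_eight hd))
  · exact not_pinnedRegions_settingPrVolSharp_of_dyadic_complete_anyPrime X M archPk archSub Ψ act Mmod region frobAdm frobLogvol frobΨ
          frobMmod unitImage ballImage thetaDiv n lat sig split qData t tq ρ qK htq0 htq1 v₀ hv₀ he2 hef

/-! ## 2. Every `F ∋ √d`, `d` squarefree, `d ∉ {1, 3}` -/

/-- **EVERY NUMBER FIELD `F ∋ s` WITH `s² = d`, `d` SQUAREFREE, `d ≠ 1`, `d ≠ 3`: `PinnedRegions` FAILS at `settingPrVolSharp`** for the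
analytic logarithms — every `X : PilotData F`, `ρ`, `qK`, column data, `Ψ`, ideles, column.  By `d mod 8`: `2 (mod 4)` / `7 (mod 8)` — §1;
`5 (mod 8)` — the dyadic places of residue degree `≥ 2` (p461750); `1, 3 (mod 8)` — a prime `q ≥ 5` exactly dividing `d` (p461750), which exists
unless `d ∈ {1, 3}`. [cite: DupuyHilado2025, §4.9] [cite: NeukirchANT1999, Ch. II Prop. (5.3), (5.5), (6.8)] [claim: Mochizuki2012, status: disputed] -/
theorem not_pinnedRegions_settingPrVolSharp_of_sq_eq_squarefree {s : F} {d : ℤ} (hs : s ^ 2 = d) (hsq : Squarefree d) (hd1 : d ≠ 1)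
    (hd3 : d ≠ 3) :
    ¬ Cor312Vol.PinnedRegions
      (LatticeSituation.ofShells (logShellsDH X (analyticLogv F)) M archPk archSub
        (summandPiecesPr X (logvAnalytic_analyticLogv (F := F))).Adm
        (summandPiecesPr X (logvAnalytic_analyticLogv (F := F))).logvol Ψ act Mmod region frobAdm frobLogvol frobΨ frobMmod
        unitImage ballImage thetaDiv)
      (settingPrVolSharp X (logvAnalytic_analyticLogv (F := F)) M archPk archSub Ψ act Mmod region n lat sig split qData tq t
        htq0 htq1) ρ qK := by
  -- squarefree: no square of a non-unit divides `d`
  have hnsq : ∀ m : ℤ, m ≠ 1 → m ≠ -1 → ¬ m * m ∣ d := fun m h1 h2 hdvd =>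
    by rcases Int.isUnit_iff.mp (hsq m hdvd) with h | h <;> [exact h1 h; exact h2 h]
  have h4 : ¬ (4 : ℤ) ∣ d := fun h => hnsq 2 (by decide) (by decide) (by simpa using h)
  -- a prime `q ≠ 2, 3` dividing `d` settles the matter
  have hbig : ∀ q : ℕ, q.Prime → q ≠ 2 → q ≠ 3 → (q : ℤ) ∣ d →
    ¬ Cor312Vol.PinnedRegions
      (LatticeSituation.ofShells (logShellsDH X (analyticLogv F)) M archPk archSub
        (summandPiecesPr X (logvAnalytic_analyticLogv (F := F))).Adm
        (summandPiecesPr X (logvAnalytic_analyticLogv (F := F))).logvol Ψ act Mmod region frobAdm frobLogvol frobΨ frobMmod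
        unitImage ballImage thetaDiv)
      (settingPrVolSharp X (logvAnalytic_analyticLogv (F := F)) M archPk archSub Ψ act Mmod region n lat sig split qData tq t
        htq0 htq1) ρ qK := by
    intro q hq hq2 hq3 hqd
    have hq4 : q ≠ 4 := fun h => by rw [h] at hq; exact absurd hq (by decide)
    have h5 : 5 ≤ q := by have := hq.two_le; omega
    refine not_pinnedRegions_settingPrVolSharp_of_sq_eq_of_prime_dvd X M archPk archSub Ψ act Mmod region frobAdm frobLogvol frobΨ
          frobMmod unitImage ballImage thetaDiv n lat sig split qData t tq ρ qK htq0 htq1 q hq h5 hs hqd fun h => ?_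
    rw [sq] at h
    exact hnsq q (by exact_mod_cast hq.one_lt.ne') (by have := hq.two_le; omega) h
  rcases (by omega : d % 4 = 2 ∨ d % 8 = 7 ∨ d % 8 = 5 ∨ (d % 2 = 1 ∧ d % 8 ≠ 5 ∧ d % 8 ≠ 7)) with h | h | h | h
  · exact not_pinnedRegions_settingPrVolSharp_of_sq_eq_two_mod_four X M archPk archSub Ψ act Mmod region frobAdm frobLogvol frobΨ
          frobMmod unitImage ballImage thetaDiv n lat sig split qData t tq ρ qK htq0 htq1 hs h
  · exact not_pinnedRegions_settingPrVolSharp_of_sq_eq_seven_mod_eight X M archPk archSub Ψ act Mmod region frobAdm frobLogvol frobΨ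
          frobMmod unitImage ballImage thetaDiv n lat sig split qData t tq ρ qK htq0 htq1 hs h
  · exact not_pinnedRegions_settingPrVolSharp_of_sq_eq_five_mod_eight X M archPk archSub Ψ act Mmod region frobAdm frobLogvol frobΨ
          frobMmod unitImage ballImage thetaDiv n lat sig split qData t tq ρ qK htq0 htq1 hs h
  · obtain ⟨hodd, h5', h7'⟩ := h
    by_cases h3 : (3 : ℤ) ∣ d
    · obtain ⟨m, hm⟩ := h3
      have h3m : ¬ (3 : ℤ) ∣ m := fun ⟨k, hk⟩ => hnsq 3 (by decide) (by decide) ⟨k, by rw [hm, hk]; ring⟩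
      by_cases hm1 : m.natAbs = 1
      · -- `d = ±3`: `−3 ≡ 5 (mod 8)` was handled, `d = 3` is excluded
        exfalso
        rcases Int.natAbs_eq m with h' | h' <;> rw [hm1] at h' <;> omega
      · obtain ⟨q, hq, hqm⟩ := Nat.exists_prime_and_dvd hm1
        have hqm' : (q : ℤ) ∣ m := Int.natCast_dvd.mpr hqm
        have hqd : (q : ℤ) ∣ d := hqm'.trans ⟨3, by rw [hm]; ring⟩
        refine hbig q hq ?_ ?_ hqd
        · rintro rfl; obtain ⟨k, hk⟩ := hqd; omega
        · rintro rfl; exact h3m hqm'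
    · have hd1' : d.natAbs ≠ 1 := fun h' => by rcases Int.natAbs_eq d with h'' | h'' <;> rw [h'] at h'' <;> omega
      obtain ⟨q, hq, hqd⟩ := Nat.exists_prime_and_dvd hd1'
      have hqd' : (q : ℤ) ∣ d := Int.natCast_dvd.mpr hqd
      refine hbig q hq ?_ ?_ hqd'
      · rintro rfl; obtain ⟨k, hk⟩ := hqd'; omega
      · rintro rfl; exact h3 hqd'

/-- The same for `PinnedRegions3`. [claim: Mochizuki2012, status: disputed] -/
theorem not_pinnedRegions3_settingPrVolSharp_of_sq_eq_squarefree {s : F} {d : ℤ} (hs : s ^ 2 = d) (hsq : Squarefree d) (hd1 : d ≠ 1)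
    (hd3 : d ≠ 3) :
    ¬ Cor312Vol.PinnedRegions3
      (LatticeSituation.ofShells (logShellsDH X (analyticLogv F)) M archPk archSub
        (summandPiecesPr X (logvAnalytic_analyticLogv (F := F))).Adm
        (summandPiecesPr X (logvAnalytic_analyticLogv (F := F))).logvol Ψ act Mmod region frobAdm frobLogvol frobΨ frobMmod
        unitImage ballImage thetaDiv)
      (settingPrVolSharp X (logvAnalytic_analyticLogv (F := F)) M archPk archSub Ψ act Mmod region n lat sig split qData tq t
        htq0 htq1) ρ qK :=
  fun h => not_pinnedRegions_settingPrVolSharp_of_sq_eq_squarefree X M archPk archSub Ψ act Mmod region frobAdm frobLogvol frobΨ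
          frobMmod unitImage ballImage thetaDiv n lat sig split qData t tq ρ qK htq0 htq1 hs hsq hd1 hd3 h.1

end Summit.ABC.IUTFork.Joshi

end
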